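import Literature.NumberTheory.LFunctions.ClassGroupLogFreeTheorem14
import Literature.NumberTheory.LFunctions.DedekindZeta1LogFreeTheorem14
import Literature.NumberTheory.LFunctions.ClassGroupLogFreeSieveConstAllDegrees
import HarnessLib

/-!
# The trivial range of Bombieri's Théorème 14 in every degree (`ζ₁_K` and the class group characters)

Topic `Literature/NumberTheory/LFunctions`, namespace `Literature.NumberTheory.LFunctions.NumberField`.
Everything here is PROVED (theorems only; no definitions, no named facts).

The tree's trivial bounds `largeRange_Z1` (`Σ_{ρ ∈ Z} m(ρ) ≤ C P²` for the zeros of `ζ₁_K` with `1/4 ≤ β ≤ 1`,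
`|γ| ≤ P`) and `largeRange_CG` (`Σ_{χ ≠ 1} Σ_{ρ ∈ Z(χ)} m(ρ) ≤ C P³` for the non-trivial class group characters)
are stated for number fields of degree `n_K ≤ 4` with an absolute `C`, the degree entering only through the
bound `discBound K j ≤ 44 log P` for the Jensen-disc counts at the integer heights `|j| ≤ P + 2`.  With
`discBound_le_of_le` (`discBound K v ≤ 10(n+1) log P` for `n_K ≤ n`, `ClassGroupLogFreeSieveConstAllDegrees.lean`)
the same proofs give the bounds for `n_K ≤ n`, ANY `n`, with `C = C(n)` linear in `n`:

* `largeRange_Z1_of_le (n)` — `Σ_{ρ ∈ Z} m(ρ) ≤ 1600(n+1) P²` for `n_K ≤ n`;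
* `largeRange_CG_of_le (n)` — `Σ_{χ ≠ 1} Σ_{ρ ∈ Z(χ)} m(ρ) ≤ 6400(n+1) P³` for `n_K ≤ n`.

These are the trivial-range inputs (`1 − α > δ₀`) of the assembly of the log-free zero-density estimates
`logFreeDensity_dedekindZeta₁…` / `logFreeDensity_classGroup…` in every degree (Weiss 1983 Thm. 4.3 /
Thorner–Zaman 2019 Thm. 3.2 without the Deuring–Heilbronn factor); statements otherwise verbatim those of the
`n_K ≤ 4` versions.

## References

* [Bombieri1987GrandCrible] E. Bombieri, Astérisque 18 (1987), §6 Théorème 14 (proof, the trivial range).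
* [ThornerZaman2019] J. Thorner, A. Zaman, Algebra Number Theory 13 (2019) 1039–1068, Thm. 3.2.
* [Weiss1983] A. Weiss, J. reine angew. Math. 338 (1983) 56–94, Thm. 4.3.
-/

noncomputable section

open Complex Finset Filter Real MeasureTheory
open scoped LSeries.notation ArithmeticFunction.vonMangoldt Topology Nat

namespace Literature.NumberTheory.LFunctions.NumberField

open Literature.NumberTheory.LFunctions.LogFreeLocal Literature.NumberTheory.LFunctions.LogFreeDensity
  Literature.NumberTheory.LFunctions.AbelianDensity
open scoped nonZeroDivisors _root_.NumberField

/-! ### `ζ₁_K` -/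

/-- **The trivial bound for `ζ_K` in every degree**: for `n_K ≤ n`, `P ≥ 2`, `|d_K| ≤ P`, and a finite set `Z`
of zeros of `ζ_K` with `1/4 ≤ β ≤ 1`, `|γ| ≤ P`: `Σ_{ρ ∈ Z} m(ρ) ≤ 1600(n+1) P²` (Jensen discs at the integer
heights, `discBound K j ≤ 10(n+1) log P`). [cite: Bombieri1987GrandCrible, §6 Théorème 14 (proof)] -/
theorem largeRange_Z1_of_le (n : ℕ) :
    ∃ C : ℝ, 0 < C ∧
      ∀ (K : Type*) [Field K] [NumberField K], Module.finrank ℚ K ≤ n →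
        ∀ P : ℝ, 2 ≤ P → ((NumberField.discr K).natAbs : ℝ) ≤ P →
        ∀ Z : Finset ℂ, (∀ ρ ∈ Z, dedekindZeta₁ K ρ = 0 ∧ 1 / 4 ≤ ρ.re ∧ ρ.re ≤ 1 ∧ |ρ.im| ≤ P) →
          ∑ ρ ∈ Z, (zeroOrder (dedekindZeta₁ K) ρ : ℝ) ≤ C * P ^ (2 : ℕ) := by
  refine ⟨32 * (10 * ((n : ℝ) + 1)) * 5, by positivity, fun K _ _ hnK P hP hd Z hZ => ?_⟩
  have hPpos : 0 < P := by linarith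
  set Lp : ℝ := Real.log P with hLp
  have hLp2 : Real.log 2 ≤ Lp := Real.log_le_log (by norm_num) hP
  have hlog2 : (0.69 : ℝ) ≤ Real.log 2 := by have := Real.log_two_gt_d9; linarith
  have hLppos : 0 < Lp := by linarith
  have hLpP : Lp ≤ P := by rw [hLp]; exact (Real.log_le_sub_one_of_pos hPpos).trans (by linarith)
  set M : ℤ := ⌈P⌉ + 1 with hM
  have hMle : (M : ℝ) ≤ P + 2 := by
    rw [hM]; push_cast; linarith [(Int.ceil_lt_add_one P).le]
  set J : Finset ℤ := Finset.Icc (-M) M with hJ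
  have hM0 : 0 ≤ M := by
    rw [hM]; have := Int.ceil_nonneg hPpos.le; omega
  have hcardJ : (J.card : ℝ) ≤ 5 * P := by
    have : (J.card : ℤ) = 2 * M + 1 := by
      rw [hJ, Int.card_Icc]; omega
    have hc : (J.card : ℝ) = 2 * M + 1 := by exact_mod_cast this
    rw [hc]; linarith
  have hdiscj : ∀ j ∈ J, discBound K j ≤ 10 * ((n : ℝ) + 1) * Lp := by
    intro j hj
    rw [hJ, Finset.mem_Icc] at hj
    have hjabs : |(j : ℝ)| ≤ P + 2 := by
      rw [abs_le]; constructor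
      · have : (-M : ℝ) ≤ j := by exact_mod_cast hj.1
        linarith
      · have : (j : ℝ) ≤ M := by exact_mod_cast hj.2
        linarith
    exact discBound_le_of_le hnK hP hd hjabs
  set f := dedekindZeta₁ K with hf
  have hdf : Differentiable ℂ f := differentiable_dedekindZeta₁ K
  set g : ℂ → ℤ := fun ρ => ⌊ρ.im + 1 / 2⌋ with hg
  have hmaps : ∀ ρ ∈ Z, g ρ ∈ J := by
    intro ρ hρ
    obtain ⟨-, -, -, him⟩ := hZ ρ hρ
    rw [hJ, Finset.mem_Icc, hg]; dsimp only
    have h1 := abs_le.1 him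
    have hc1 : (⌈P⌉ : ℝ) ≥ P := Int.le_ceil _
    constructor
    · rw [hM]
      have : (-(⌈P⌉ + 1) : ℤ) ≤ ⌊ρ.im + 1 / 2⌋ := by
        rw [Int.le_floor]; push_cast; linarith
      linarith
    · rw [hM]
      have : ⌊ρ.im + 1 / 2⌋ < ⌈P⌉ + 1 + 1 := by
        rw [Int.floor_lt]; push_cast; linarith
      omega
  have hfib : ∀ j ∈ J, ∑ ρ ∈ Z.filter (fun ρ => g ρ = j), (zeroOrder f ρ : ℝ) ≤ 32 * (10 * ((n : ℝ) + 1) * Lp) := by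
    intro j hj
    have hfc : f (2 + ((j : ℝ) : ℂ) * I) ≠ 0 := dedekindZeta₁_two_add_ne_zero (j : ℝ)
    have hsub : Z.filter (fun ρ => g ρ = j) ⊆ discZeros f (j : ℝ) := by
      intro ρ hρ
      rw [mem_filter] at hρ
      obtain ⟨h0, hβ, hβ1, -⟩ := hZ ρ hρ.1
      refine (mem_discZeros hdf hfc).2 ⟨?_, h0⟩
      rw [Metric.mem_closedBall, dist_eq_norm]
      have hγ : |ρ.im - j| ≤ 1 / 2 := by
        have hgj := hρ.2
        rw [hg] at hgj; dsimp only at hgj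
        have h1 := Int.floor_le (ρ.im + 1 / 2)
        have h2 := Int.lt_floor_add_one (ρ.im + 1 / 2)
        rw [hgj] at h1 h2
        rw [abs_le]; constructor <;> linarith
      have hre : (ρ - (2 + ((j : ℝ) : ℂ) * I)).re = ρ.re - 2 := by simp
      have him' : (ρ - (2 + ((j : ℝ) : ℂ) * I)).im = ρ.im - j := by simp
      have hsq : ‖ρ - (2 + ((j : ℝ) : ℂ) * I)‖ ^ 2 ≤ (31 / 16 : ℝ) ^ 2 := by
        rw [Complex.sq_norm, Complex.normSq_apply, hre, him']
        have h1 : (ρ.re - 2) * (ρ.re - 2) ≤ (7 / 4) ^ 2 := by nlinarith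
        have h2 : (ρ.im - j) * (ρ.im - j) ≤ (1 / 2) ^ 2 := by
          have := abs_le.1 hγ; nlinarith
        nlinarith
      nlinarith [norm_nonneg (ρ - (2 + ((j : ℝ) : ℂ) * I))]
    calc ∑ ρ ∈ Z.filter (fun ρ => g ρ = j), (zeroOrder f ρ : ℝ)
        = ∑ ρ ∈ Z.filter (fun ρ => g ρ = j), (discDivisor f (j : ℝ) ρ : ℝ) := by
          refine sum_congr rfl fun ρ hρ => ?_
          rw [discDivisor_eq_zeroOrder hdf hfc ((mem_discZeros hdf hfc).1 (hsub hρ)).1]; norm_cast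
      _ ≤ ∑ ρ ∈ discZeros f (j : ℝ), (discDivisor f (j : ℝ) ρ : ℝ) :=
          sum_le_sum_of_subset_of_nonneg hsub fun ρ _ _ => by exact_mod_cast discDivisor_nonneg hdf _ ρ
      _ ≤ 32 * discBound K (j : ℝ) := sum_divisor_dedekindZeta₁_bigDisc_le (K := K) _
      _ ≤ 32 * (10 * ((n : ℝ) + 1) * Lp) := mul_le_mul_of_nonneg_left (hdiscj j hj) (by norm_num)
  rw [← Finset.sum_fiberwise_of_maps_to hmaps]
  calc ∑ j ∈ J, ∑ ρ ∈ Z.filter (fun ρ => g ρ = j), (zeroOrder f ρ : ℝ)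
      ≤ ∑ _j ∈ J, 32 * (10 * ((n : ℝ) + 1) * Lp) := sum_le_sum hfib
    _ = J.card * (32 * (10 * ((n : ℝ) + 1) * Lp)) := by rw [sum_const, nsmul_eq_mul]
    _ ≤ (5 * P) * (32 * (10 * ((n : ℝ) + 1) * Lp)) := mul_le_mul_of_nonneg_right hcardJ (by positivity)
    _ ≤ (5 * P) * (32 * (10 * ((n : ℝ) + 1) * P)) := by gcongr
    _ = 32 * (10 * ((n : ℝ) + 1)) * 5 * P ^ (2 : ℕ) := by ring

/-! ### The class group characters -/

open scoped Classical in
/-- **The trivial bound for the class group characters in every degree**: for `n_K ≤ n`, `P ≥ 2` with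
`|d_K| ≤ P` and `h_K ≤ P`, and finite sets `Z(χ)` of zeros of `L₀(s, χ)` (`χ ≠ 1`) with `1/4 ≤ β ≤ 1` and
`|γ| ≤ P`: `Σ_{χ ≠ 1} Σ_{ρ ∈ Z(χ)} m(ρ) ≤ 6400(n+1) P³` (each zero lies in the Jensen disc `|ρ − (2 + ij)| ≤ 31/16`
about the nearest integer height `j`, whose count is `≤ 128 · discBound ≤ 1280(n+1) log P`).
[cite: Bombieri1987GrandCrible, §6 Théorème 14 (proof)] -/
theorem largeRange_CG_of_le (n : ℕ) :
    ∃ C : ℝ, 0 < C ∧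
      ∀ (K : Type*) [Field K] [NumberField K], Module.finrank ℚ K ≤ n →
        ∀ P : ℝ, 2 ≤ P → ((NumberField.discr K).natAbs : ℝ) ≤ P → (Fintype.card (ClassGroup (𝓞 K)) : ℝ) ≤ P →
        ∀ Z : (ClassGroup (𝓞 K) →* ℂˣ) → Finset ℂ,
          (∀ χ : ClassGroup (𝓞 K) →* ℂˣ, χ ≠ 1 → ∀ ρ ∈ Z χ,
              classGroupLFunction₀ K χ ρ = 0 ∧ 1 / 4 ≤ ρ.re ∧ ρ.re ≤ 1 ∧ |ρ.im| ≤ P) →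
          ∑ ψ : AddChar (Additive (ClassGroup (𝓞 K))) ℂ with ψ ≠ 0,
            ∑ ρ ∈ Z (toMulHom ψ).toHomUnits,
              (zeroOrder (classGroupLFunction₀ K (toMulHom ψ).toHomUnits) ρ : ℝ) ≤ C * P ^ (3 : ℕ) := by
  refine ⟨128 * (10 * ((n : ℝ) + 1)) * 5, by positivity, fun K _ _ hnK P hP hd hh Z hZ => ?_⟩
  have hPpos : 0 < P := by linarith
  set Lp : ℝ := Real.log P with hLp
  have hLp2 : Real.log 2 ≤ Lp := Real.log_le_log (by norm_num) hP
  have hlog2 : (0.69 : ℝ) ≤ Real.log 2 := by have := Real.log_two_gt_d9; linarith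
  have hLppos : 0 < Lp := by linarith
  have hLpP : Lp ≤ P := by rw [hLp]; exact (Real.log_le_sub_one_of_pos hPpos).trans (by linarith)
  -- the windows
  set M : ℤ := ⌈P⌉ + 1 with hM
  have hMle : (M : ℝ) ≤ P + 2 := by
    rw [hM]; push_cast; linarith [(Int.ceil_lt_add_one P).le]
  set J : Finset ℤ := Finset.Icc (-M) M with hJ
  have hM0 : 0 ≤ M := by
    rw [hM]; have := Int.ceil_nonneg hPpos.le; omega
  have hcardJ : (J.card : ℝ) ≤ 5 * P := by
    have : (J.card : ℤ) = 2 * M + 1 := by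
      rw [hJ, Int.card_Icc]; omega
    have hc : (J.card : ℝ) = 2 * M + 1 := by exact_mod_cast this
    rw [hc]; linarith
  -- `discBound K j ≤ 10(n+1) Lp` at the heights `|j| ≤ M ≤ P + 2`
  have hdiscj : ∀ j ∈ J, discBound K j ≤ 10 * ((n : ℝ) + 1) * Lp := by
    intro j hj
    rw [hJ, Finset.mem_Icc] at hj
    have hjabs : |(j : ℝ)| ≤ P + 2 := by
      rw [abs_le]; constructor
      · have : (-M : ℝ) ≤ j := by exact_mod_cast hj.1
        linarith
      · have : (j : ℝ) ≤ M := by exact_mod_cast hj.2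
        linarith
    exact discBound_le_of_le hnK hP hd hjabs
  -- per character
  have hper : ∀ ψ : AddChar (Additive (ClassGroup (𝓞 K))) ℂ, ψ ≠ 0 →
      ∑ ρ ∈ Z (toMulHom ψ).toHomUnits, (zeroOrder (classGroupLFunction₀ K (toMulHom ψ).toHomUnits) ρ : ℝ) ≤
        (5 * P) * (128 * (10 * ((n : ℝ) + 1) * Lp)) := by
    intro ψ hψ
    set χ := (toMulHom ψ).toHomUnits with hχ
    have hχ1 : χ ≠ 1 := toHomUnits_ne_one hψ
    set f := classGroupLFunction₀ K χ with hf
    have hdf : Differentiable ℂ f := differentiable_classGroupLFunction₀ χ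
    -- fibres over the nearest integer to `γ`
    set g : ℂ → ℤ := fun ρ => ⌊ρ.im + 1 / 2⌋ with hg
    have hmaps : ∀ ρ ∈ Z χ, g ρ ∈ J := by
      intro ρ hρ
      obtain ⟨-, -, -, him⟩ := hZ χ hχ1 ρ hρ
      rw [hJ, Finset.mem_Icc, hg]; dsimp only
      have h1 := abs_le.1 him
      have hc1 : (⌈P⌉ : ℝ) ≥ P := Int.le_ceil _
      constructor
      · rw [hM]
        have : (-(⌈P⌉ + 1) : ℤ) ≤ ⌊ρ.im + 1 / 2⌋ := by
          rw [Int.le_floor]; push_cast; linarith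
        linarith
      · rw [hM]
        have : ⌊ρ.im + 1 / 2⌋ ≤ (⌈P⌉ + 1 : ℤ) := by
          have : ⌊ρ.im + 1 / 2⌋ < ⌈P⌉ + 1 + 1 := by
            rw [Int.floor_lt]; push_cast; linarith
          omega
        exact this
    -- each fibre lies in the Jensen disc about `2 + ij`
    have hfib : ∀ j ∈ J, ∑ ρ ∈ (Z χ).filter (fun ρ => g ρ = j), (zeroOrder f ρ : ℝ) ≤ 128 * (10 * ((n : ℝ) + 1) * Lp) := by
      intro j hj
      have hfc : f (2 + ((j : ℝ) : ℂ) * I) ≠ 0 := classGroupLFunction₀_two_add_ne_zero hχ1 (j : ℝ)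
      have hsub : (Z χ).filter (fun ρ => g ρ = j) ⊆ discZeros f (j : ℝ) := by
        intro ρ hρ
        rw [mem_filter] at hρ
        obtain ⟨h0, hβ, hβ1, -⟩ := hZ χ hχ1 ρ hρ.1
        refine (mem_discZeros hdf hfc).2 ⟨?_, h0⟩
        rw [Metric.mem_closedBall, dist_eq_norm]
        have hγ : |ρ.im - j| ≤ 1 / 2 := by
          have hgj := hρ.2
          rw [hg] at hgj; dsimp only at hgj
          have h1 := Int.floor_le (ρ.im + 1 / 2)
          have h2 := Int.lt_floor_add_one (ρ.im + 1 / 2)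
          rw [hgj] at h1 h2
          rw [abs_le]; constructor <;> linarith
        have hre : (ρ - (2 + ((j : ℝ) : ℂ) * I)).re = ρ.re - 2 := by simp
        have him' : (ρ - (2 + ((j : ℝ) : ℂ) * I)).im = ρ.im - j := by simp
        have hsq : ‖ρ - (2 + ((j : ℝ) : ℂ) * I)‖ ^ 2 ≤ (31 / 16 : ℝ) ^ 2 := by
          rw [Complex.sq_norm, Complex.normSq_apply, hre, him']
          have h1 : (ρ.re - 2) * (ρ.re - 2) ≤ (7 / 4) ^ 2 := by nlinarith
          have h2 : (ρ.im - j) * (ρ.im - j) ≤ (1 / 2) ^ 2 := by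
            have := abs_le.1 hγ; nlinarith
          nlinarith
        nlinarith [norm_nonneg (ρ - (2 + ((j : ℝ) : ℂ) * I))]
      calc ∑ ρ ∈ (Z χ).filter (fun ρ => g ρ = j), (zeroOrder f ρ : ℝ)
          = ∑ ρ ∈ (Z χ).filter (fun ρ => g ρ = j), (discDivisor f (j : ℝ) ρ : ℝ) := by
            refine sum_congr rfl fun ρ hρ => ?_
            rw [discDivisor_eq_zeroOrder hdf hfc ((mem_discZeros hdf hfc).1 (hsub hρ)).1]; norm_cast
        _ ≤ ∑ ρ ∈ discZeros f (j : ℝ), (discDivisor f (j : ℝ) ρ : ℝ) :=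
            sum_le_sum_of_subset_of_nonneg hsub fun ρ _ _ => by exact_mod_cast discDivisor_nonneg hdf _ ρ
        _ ≤ 128 * discBound K (j : ℝ) := sum_discDivisor_classGroupLFunction₀_le hχ1 _
        _ ≤ 128 * (10 * ((n : ℝ) + 1) * Lp) := mul_le_mul_of_nonneg_left (hdiscj j hj) (by norm_num)
    rw [← Finset.sum_fiberwise_of_maps_to hmaps]
    calc ∑ j ∈ J, ∑ ρ ∈ (Z χ).filter (fun ρ => g ρ = j), (zeroOrder f ρ : ℝ)
        ≤ ∑ _j ∈ J, 128 * (10 * ((n : ℝ) + 1) * Lp) := sum_le_sum hfib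
      _ = J.card * (128 * (10 * ((n : ℝ) + 1) * Lp)) := by rw [sum_const, nsmul_eq_mul]
      _ ≤ (5 * P) * (128 * (10 * ((n : ℝ) + 1) * Lp)) := mul_le_mul_of_nonneg_right hcardJ (by positivity)
  -- sum over `ψ ≠ 0`: at most `h_K ≤ P` characters
  have hcardψ : (((univ : Finset (AddChar (Additive (ClassGroup (𝓞 K))) ℂ)).filter (fun ψ => ψ ≠ 0)).card : ℝ) ≤ P := by
    calc (((univ : Finset (AddChar (Additive (ClassGroup (𝓞 K))) ℂ)).filter (fun ψ => ψ ≠ 0)).card : ℝ)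
        ≤ (Fintype.card (AddChar (Additive (ClassGroup (𝓞 K))) ℂ) : ℝ) := by
          exact_mod_cast (card_le_card (filter_subset _ _)).trans (Finset.card_univ.le)
      _ = Fintype.card (ClassGroup (𝓞 K)) := by
          rw [card_addChar_classGroup]; rfl
      _ ≤ P := hh
  calc ∑ ψ ∈ (univ : Finset (AddChar (Additive (ClassGroup (𝓞 K))) ℂ)).filter (fun ψ => ψ ≠ 0),
        ∑ ρ ∈ Z (toMulHom ψ).toHomUnits, (zeroOrder (classGroupLFunction₀ K (toMulHom ψ).toHomUnits) ρ : ℝ)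
      ≤ ∑ ψ ∈ (univ : Finset (AddChar (Additive (ClassGroup (𝓞 K))) ℂ)).filter (fun ψ => ψ ≠ 0),
          (5 * P) * (128 * (10 * ((n : ℝ) + 1) * Lp)) := sum_le_sum fun ψ hψ => hper ψ (mem_filter.1 hψ).2
    _ = (((univ : Finset (AddChar (Additive (ClassGroup (𝓞 K))) ℂ)).filter (fun ψ => ψ ≠ 0)).card : ℝ) *
          ((5 * P) * (128 * (10 * ((n : ℝ) + 1) * Lp))) := by rw [sum_const, nsmul_eq_mul]
    _ ≤ P * ((5 * P) * (128 * (10 * ((n : ℝ) + 1) * Lp))) := mul_le_mul_of_nonneg_right hcardψ (by positivity)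
    _ ≤ P * ((5 * P) * (128 * (10 * ((n : ℝ) + 1) * P))) := by gcongr
    _ = 128 * (10 * ((n : ℝ) + 1)) * 5 * P ^ (3 : ℕ) := by ring

end Literature.NumberTheory.LFunctions.NumberField

end
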